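import Mathlib
import Summits.ValiantsHypothesis.ValiantsHypothesis.Theorems.LiouvilleSarnakAlignedTypeICharactersMod2nBilinearSieveKorobovBlock
import Summits.ValiantsHypothesis.ValiantsHypothesis.Theorems.LiouvilleSarnakAlignedTypeICharactersMod2nBilinearSieveKorobovParams
import HarnessLib

/-!
# Route LiouvilleSarnak — support `AlignedTypeI` (stmt-ValiantsHypothesis-21040), line `characters_mod_2n`:
# the Postnikov–Gallagher–Korobov block bound in the main range (depth-aspect Ivić Theorem 6.2)

Brick (B5b) of `HS` (short character sums mod `q = 2^j`): the block bound with explicit parameters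
(`…KorobovBlock.lean`) specialised to the verified parameter choice (`…KorobovParams.lean`).  For a primitive
character `χ` mod `2^{n+τ}` (`j = n + τ`), reals `Y ≥ 10`, `L ≥ 10⁶Y²` with `j log 2 = Y L` (in the application
`L = log N`, `Y = log q/log N`), `r = ⌊5.01Y⌋` and `τ = ⌊j/(r+1)⌋ + 2`:

  `‖Σ_{M < m ≤ M+N} χ(m)‖ ≤ N e^{10} exp(−2·10⁻⁶ L/Y²) + 8 e^{0.98 L}`   for every `M, N`

(`norm_charSum_Ioc_le_main`) — the `q = 2^j` analogue of Ivić's Theorem 6.2 / Vinogradov's zeta-sum estimate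
(Postnikov 1955, Gallagher 1972, Iwaniec 1974), now a tree theorem with every input PROVED (Postnikov's formula,
Gallagher's shift, Vinogradov's mean value theorem `J_le_four`, Korobov's `norm_Usum_pow_le`).

What remains for `HS(C₁, c)` of `…GrowthFromCharSums.lean` (and hence the leaf via `alignedTypeI_of_shortCharSums`):
pure bookkeeping — given `j ≥ 1`, `χ` primitive mod `2^j`, `1 ≤ N ≤ 2^j`: (i) if `log N ≥ 10⁶ (j log 2/log N)²`
and `N ≤ q^{1/10}`, split `j = n + τ` as above (transport `χ` along `2^j = 2^{n+τ}`) and use this theorem with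
`M = 0` (`8e^{0.98L} = 8N^{0.98} ≤ 8N exp(−2·10⁻⁶ L/Y²)` as `2·10⁻⁶/Y² ≤ 0.02`); (ii) if `N > q^{1/10}`, cut `(0, N]`
into blocks of length `⌊q^{1/10}⌋` and apply (i) to each (saving `exp(−2·10⁻⁹ j log 2)` per block); (iii) the
remaining small range `log³N < 10⁶ log²q` is absorbed by the constant (`exp(c log³N/log²q) ≤ e` for `c = 10⁻⁶`).

HONEST FRAMING. Helper theorem (unconditional); the leaf `AlignedTypeI` is NOT closed here; nothing bears on
`VP ≠ VNP` (NOT proved).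
-/

set_option linter.dupNamespace false

noncomputable section

namespace Summit.ValiantsHypothesis.ValiantsHypothesis.Theorems.LiouvilleSarnak.AlignedTypeI.CharactersModTwoN

open Finset Real
open Literature.NumberTheory.LFunctions

/-- ★★ **The Postnikov–Gallagher–Korobov block bound, main range** (`q = 2^{n+τ}` analogue of Ivić's Theorem 6.2):
for a primitive `χ` mod `2^{n+τ}`, `Y ≥ 10`, `L ≥ 10⁶Y²`, `(n+τ) log 2 = Y L`, `r = ⌊5.01Y⌋`, `τ = ⌊(n+τ)/(r+1)⌋ + 2`:
`‖Σ_{M<m≤M+N} χ(m)‖ ≤ N e^{10} exp(−2·10⁻⁶ L/Y²) + 8 e^{0.98 L}` for all `M, N`.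
[cite: Ivic1985, Theorem 6.2] [cite: IwaniecKowalski2004, §12.3 (Postnikov–Gallagher)] -/
theorem norm_charSum_Ioc_le_main {τ n : ℕ} (χ : DirichletCharacter ℂ (2 ^ (n + τ))) (hχ : χ.IsPrimitive)
    {L Y : ℝ} {r : ℕ} (hY : 10 ≤ Y) (hL : (10 : ℝ) ^ 6 * Y ^ 2 ≤ L)
    (hj : ((n + τ : ℕ) : ℝ) * Real.log 2 = Y * L) (hr : r = ⌊5.01 * Y⌋₊)
    (hτ : τ = (n + τ) / (r + 1) + 2) (M N : ℕ) :
    ‖∑ m ∈ Ioc M (M + N), χ (m : ZMod (2 ^ (n + τ)))‖ ≤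
      (N : ℝ) * Real.exp 10 * Real.exp (-(2e-6 * L / Y ^ 2)) + 8 * Real.exp (0.98 * L) := by
  -- the remaining parameters
  set a : ℕ := ⌊Real.exp (0.39 * L)⌋₊ with ha
  set k : ℕ := 5 * r ^ 2 with hk
  set M₂ : ℕ := ⌊2 * Y⌋₊ with hM₂
  set M₃ : ℕ := ⌊3.5 * Y⌋₊ with hM₃
  obtain ⟨hr1, hr2, hr50, hτ2, hτj, hrj, ha1, hahi, hM3r, hG1, hG2⟩ :=
    params_basic hY hL hj hr hτ ha hM₂ hM₃
  have hn : 1 ≤ n := by omega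
  have htrunc : ∀ m : ℕ, r < m → m ≤ n + τ → n + τ + padicValNat 2 m ≤ τ * m :=
    fun m hrm _ => params_trunc hτ m hrm
  have hgood : ∀ m : ℕ, M₂ < m → m ≤ M₃ → τ * m < n + τ + padicValNat 2 m ∧
      (2 : ℝ) ^ (n + τ + padicValNat 2 m - τ * m) ≤ (k : ℝ) * (a : ℝ) ^ m ∧
      (4 + Real.log (2 ^ (n + τ + padicValNat 2 m - τ * m))) / 2 ^ (n + τ + padicValNat 2 m - τ * m) ≤
        VKZeta.thetaStar L Y :=
    fun m hm1 hm2 => params_good hY hL hj hr hτ ha hk hM₂ hM₃ m hm1 hm2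
  have hblock := norm_charSum_Ioc_le_of_params hτ2 hn χ hχ hY hL hr1 hr2 hr50 hk ha1 hahi hrj hM3r hG1 hG2
    htrunc hgood M N
  have herr := params_err hY hL hj hr hτ ha
  linarith

end Summit.ValiantsHypothesis.ValiantsHypothesis.Theorems.LiouvilleSarnak.AlignedTypeI.CharactersModTwoN
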